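import Mathlib
import Summits.ValiantsHypothesis.ValiantsHypothesis.Theorems.FifoMatchingNNLinearDegreeCofactorHardInflateWordHeights
import Summits.ValiantsHypothesis.ValiantsHypothesis.Theorems.FifoMatchingNNLinearDegreeCofactorHardPairWalkBand
import HarnessLib

/-!
# Route FifoMatching — crux `NNLinearDegreeCofactorHard` (stmt-ValiantsHypothesis-23918), line `internal_cofactor`:
# stub S2b, unit (E″) — the BAND for the inflated queue word (SPEC S7), bridge to the pair walk

SPEC `Lines/internal_cofactor-S2b-SPEC.md` S7: `Band y :⇔ ∀ t ∈ [A, E′], |h t − H t| ≤ m`, where `h t = #U<t − #D<t`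
is the height of the word `InflateWord.inflateWord R L m y` (unit (A″), `…InflateWordDefs/Ranks`), `H t = L + need t`
its envelope (S3), `A = vpos (2·jA)` the end of the head and `E′ = tailStart` the start of the tail.  This file
proves that OFF the band the CENTRED PAIR WALK of `…PairWalkBand` is far from `0`, and hence counts the bit
strings violating the band:

* `dev_step` — across a position `s < E′` the deviation `dev t := h t − (L + need t)` changes by `0` at a defect
  (a pop; the envelope falls with it) and by `±1 − [s starts an inflation pair]` at a non-defect letter;
* `dev_eq_dev_add_sum` — for `A ≤ t ≤ E′`: `dev t = dev A + ∑_{A ≤ s < t, s ∉ R} Δ s`;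
* `sum_delta_eq_sum_Ico`, `sum_Ico_eq_pairs_add`, `abs_delta_le` — the sum of `Δ` over `[A, t)` is a walk on
  V-ranks, grouped in pairs `jA ≤ j < ⌊v/2⌋` (`v = vrank t`) plus a boundary term of absolute value `≤ 2`;
* `delta_pair_eq` — the two increments of a middle pair add up to the CENTRED PAIR STEP `X_j` of `…PairWalkBand`
  (decoder schedule `τ j = isInflate j`); the count `#{y : band violated} ≤ 2J·exp(−m₀²/(8J))·4^J` is assembled
  from these pieces and `card_filter_pairWalk_exits_le_of_mask` in `…InflateBandCount.lean`.

Honest framing: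
bookkeeping for one unit of one stub of an OPEN crux; nothing here bears on the crux, `NNDivisionHard`, `NNNotVP`
or `VP ≠ VNP` (NOT proved).  No definitions, no named facts. [folklore]
-/

noncomputable section

-- Sub = Summit single-conjunct layout: the duplicated namespace component is mandated by the tree.
set_option linter.dupNamespace false

namespace Summit.ValiantsHypothesis.ValiantsHypothesis.Theorems.FifoMatching.NNLinearDegreeCofactorHard.InflateBand

open Finset Real
open Summit.ValiantsHypothesis.ValiantsHypothesis.Theorems.FifoMatching.NNLinearDegreeCofactorHard.InflateWord

variable {N : ℕ} (R : Finset (Fin N)) (L m : ℕ) (y : Fin (2 * (Rᶜ.card / 2)) → Bool)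

/-! ### Positions before the tail have V-rank below `2·jE` -/
/-- A non-defect position before the tail start has V-rank `< 2·jE`. [folklore] -/
theorem vrank_lt_of_lt_tailStart {s : Fin N} (hs : s ∉ R) (hlt : (s : ℕ) < tailStart R L m) :
    vrank R s < 2 * tailPairs R L m := by
  by_cases h2 : 2 * tailPairs R L m < Rᶜ.card
  · have h1 : vrank R ((s : ℕ) + 1) = vrank R s + 1 := by rw [vrank_succ, if_neg hs]
    have h3 : vrank R ((s : ℕ) + 1) ≤ vrank R (tailStart R L m) := vrank_mono R (by omega)
    unfold tailStart at h3
    rw [vrank_vpos R h2] at h3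
    omega
  · exact lt_of_lt_of_le (vrank_lt_card R hs) (not_lt.1 h2)

/-- The V-rank of the tail start is `2·jE` (when `2·jE < #Rᶜ`) — in general `vrank E′ ≥ 2·jE` suffices below;
here: every V-rank below `vrank E′` is below `2·jE`. [folklore] -/
theorem vrank_tailStart_le : vrank R (tailStart R L m) ≤ 2 * tailPairs R L m := by
  by_cases h2 : 2 * tailPairs R L m < Rᶜ.card
  · unfold tailStart; rw [vrank_vpos R h2]
  · unfold tailStart; rw [vpos_of_le R (not_lt.1 h2), vrank_of_le R le_rfl]; exact not_lt.1 h2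


/-! ### Positions before the tail have V-rank below `2·jE` -/
/-! ### Prefix sums of `±1` over a word -/
/-- The signed prefix sum `∑_{s<t} (W s ? 1 : −1)` steps by the letter at `t`. [folklore] -/
theorem prefixSum_succ (W : Fin N → Bool) (t : Fin N) :
    (∑ s : Fin N, (if (s : ℕ) < (t : ℕ) + 1 then (if W s then (1 : ℤ) else -1) else 0)) =
      (∑ s : Fin N, (if (s : ℕ) < (t : ℕ) then (if W s then (1 : ℤ) else -1) else 0)) +
        (if W t then (1 : ℤ) else -1) := by
  have hsplit : ∀ s : Fin N, (if (s : ℕ) < (t : ℕ) + 1 then (if W s then (1 : ℤ) else -1) else 0) =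
      (if (s : ℕ) < (t : ℕ) then (if W s then (1 : ℤ) else -1) else 0) +
        (if s = t then (if W s then (1 : ℤ) else -1) else 0) := by
    intro s
    by_cases h1 : (s : ℕ) < t
    · have h2 : s ≠ t := fun h => by subst h; exact lt_irrefl _ h1
      have h3 : (s : ℕ) < (t : ℕ) + 1 := by omega
      simp only [h1, h3, h2, if_true, if_false, add_zero]
    · by_cases h2 : s = t
      · subst h2; simp
      · have h3 : ¬ ((s : ℕ) < (t : ℕ) + 1) := fun h => h2 (Fin.ext (by omega))
        simp only [h3, h1, h2, if_false, add_zero]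
  rw [Finset.sum_congr rfl fun s _ => hsplit s, sum_add_distrib, Fintype.sum_ite_eq']

/-! ### Reindexing non-defect positions by V-rank -/
/-- **Non-defect positions between `vpos a` and `vpos b` are the V-positions of ranks `a ≤ i < b`.** [folklore] -/
theorem sum_nondefect_eq_sum_Ico {β : Type*} [AddCommMonoid β] (f : ℕ → β) {a b : ℕ} (hab : a ≤ b)
    (hb : b ≤ Rᶜ.card) :
    ∑ s ∈ (univ : Finset (Fin N)).filter
        (fun s : Fin N => vpos R a ≤ (s : ℕ) ∧ (s : ℕ) < vpos R b ∧ s ∉ R), f (vrank R s) =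
      ∑ i ∈ Ico a b, f i := by
  refine sum_bij' (fun s _ => vrank R s)
    (fun i hi => ⟨vpos R i, vpos_lt R (lt_of_lt_of_le (mem_Ico.1 hi).2 hb)⟩)
    (fun s hs => ?_) (fun i hi => ?_) (fun s hs => ?_) (fun i hi => ?_) (fun s hs => rfl)
  · simp only [mem_filter, mem_univ, true_and] at hs
    obtain ⟨h1, h2, h3⟩ := hs
    rw [mem_Ico]
    constructor
    · -- `a ≤ vrank s`
      by_cases ha : a < Rᶜ.card
      · rw [← vrank_vpos R ha]; exact vrank_mono R h1
      · exfalso; rw [vpos_of_le R (not_lt.1 ha)] at h1; exact absurd s.isLt (not_lt.2 h1)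
    · -- `vrank s < b`
      have hstep : vrank R ((s : ℕ) + 1) = vrank R s + 1 := by rw [vrank_succ, if_neg h3]
      rcases Nat.eq_or_lt_of_le hb with rfl | hb'
      · exact vrank_lt_card R h3
      · have := vrank_mono R (show (s : ℕ) + 1 ≤ vpos R b by omega)
        rw [hstep, vrank_vpos R hb'] at this
        omega
  · have hi' := mem_Ico.1 hi
    have hiC : i < Rᶜ.card := lt_of_lt_of_le hi'.2 hb
    simp only [mem_filter, mem_univ, true_and]
    refine ⟨vpos_le_vpos R hi'.1 hiC.le, ?_, vpos_not_mem R hiC⟩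
    rcases Nat.eq_or_lt_of_le hb with rfl | hb'
    · rw [vpos_of_le R le_rfl]; exact vpos_lt R hiC
    · exact vpos_lt_vpos R hi'.2 hb'
  · simp only [mem_filter, mem_univ, true_and] at hs
    exact Fin.ext (vpos_vrank R hs.2.2)
  · exact vrank_vpos R (lt_of_lt_of_le (mem_Ico.1 hi).2 hb)

/-- Pairing consecutive indices: `∑_{2a ≤ i < 2k} g i = ∑_{a ≤ j < k} (g (2j) + g (2j+1))`. [folklore] -/
theorem sum_Ico_two_mul {β : Type*} [AddCommMonoid β] (g : ℕ → β) (a : ℕ) :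
    ∀ k, a ≤ k → ∑ i ∈ Ico (2 * a) (2 * k), g i = ∑ j ∈ Ico a k, (g (2 * j) + g (2 * j + 1))
  | k, hk => by
    induction k, hk using Nat.le_induction with
    | base => simp
    | succ k hk ih =>
      rw [Nat.mul_succ, sum_Ico_succ_top (by omega), sum_Ico_succ_top (by omega), ih,
        sum_Ico_succ_top hk, add_assoc]


/-! ### Positions versus V-positions -/
/-- For a non-defect `s` and `t ≤ N`: `s < t ↔ s < vpos (vrank t)`. [folklore] -/
theorem lt_iff_lt_vpos_vrank {s : Fin N} (hs : s ∉ R) (t : ℕ) :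
    (s : ℕ) < t ↔ (s : ℕ) < vpos R (vrank R t) := by
  have hstep : vrank R ((s : ℕ) + 1) = vrank R s + 1 := by rw [vrank_succ, if_neg hs]
  constructor
  · intro h
    have h1 : vrank R s < vrank R t := by
      have := vrank_mono R (show (s : ℕ) + 1 ≤ t by omega); omega
    by_cases h2 : vrank R t < Rᶜ.card
    · have := vpos_lt_vpos R h1 h2; rwa [vpos_vrank R hs] at this
    · rw [vpos_of_le R (not_lt.1 h2)]; exact s.isLt
  · intro h
    by_contra h'
    have h1 : vrank R t ≤ vrank R s := vrank_mono R (not_lt.1 h')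
    have h2 := vpos_le_vpos R h1 (vrank_lt_card R hs).le
    rw [vpos_vrank R hs] at h2
    omega

/-! ### The deviation `h − (L + need)` and its increments -/
/-- **One step of the deviation** below the tail start: across a defect (a pop) the height and the envelope both
fall by one; across a non-defect letter the deviation moves by `±1 − [inflation pair start]`. [folklore] -/
theorem dev_step (t : Fin N) (ht : (t : ℕ) < tailStart R L m) :
    (∑ s : Fin N, (if (s : ℕ) < (t : ℕ) + 1 then (if inflateWord R L m y s then (1 : ℤ) else -1) else 0))
        - (need R L m ((t : ℕ) + 1) : ℤ) =
      ((∑ s : Fin N, (if (s : ℕ) < (t : ℕ) then (if inflateWord R L m y s then (1 : ℤ) else -1) else 0))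
        - (need R L m t : ℤ)) +
      (if t ∈ R then 0 else
        ((if inflateWord R L m y t then (1 : ℤ) else -1) -
          (if vrank R t % 2 = 0 ∧ 0 < need R L m ((t : ℕ) + 1) then 1 else 0))) := by
  rw [prefixSum_succ]
  by_cases htR : t ∈ R
  · rw [if_pos htR, inflateWord_apply_of_mem R L m y htR, need_of_mem R L m htR ht]
    push_cast; ring
  · rw [if_neg htR, need_of_not_mem R L m htR ht]
    by_cases hc : vrank R t % 2 = 0 ∧ 0 < need R L m ((t : ℕ) + 1)
    · rw [if_pos hc, if_pos hc]
      obtain ⟨k, hk⟩ : ∃ k, need R L m ((t : ℕ) + 1) = k + 1 := ⟨_, (Nat.succ_pred_eq_of_pos hc.2).symm⟩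
      rw [hk, Nat.add_sub_cancel]; push_cast; ring
    · rw [if_neg hc, if_neg hc]; ring

/-- The increment at a non-defect position before the tail, read off the V-rank: the letter is `preLetter (vrank s)`
and «inflation pair start» is `isInflate (vrank s / 2)` at even V-rank. [folklore] -/
theorem delta_eq_of_not_mem {s : Fin N} (hs : s ∉ R) (hlt : (s : ℕ) < tailStart R L m) :
    ((if inflateWord R L m y s then (1 : ℤ) else -1) -
        (if vrank R s % 2 = 0 ∧ 0 < need R L m ((s : ℕ) + 1) then 1 else 0)) =
      ((if preLetter R L m y (vrank R s) then (1 : ℤ) else -1) -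
        (if vrank R s % 2 = 0 ∧ isInflate R L m (vrank R s / 2) = true then 1 else 0)) := by
  rw [inflateWord_apply_of_lt R L m y hs (vrank_lt_of_lt_tailStart R L m hs hlt)]
  congr 1
  by_cases he : vrank R s % 2 = 0
  · have h2 : 2 * (vrank R s / 2) = vrank R s := by omega
    unfold isInflate
    rw [h2, vpos_vrank R hs]
    simp only [he, true_and, decide_eq_true_eq]
  · rw [if_neg (fun h => he h.1), if_neg (fun h => he h.1)]

/-- **Telescoping.**  For `A ≤ t ≤ E′` (`A` any base point): the deviation at `t` is the deviation at `A` plus the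
increments over the non-defect positions in `[A, t)`. [folklore] -/
theorem dev_eq_dev_add_sum {A : ℕ} (t : ℕ) (hAt : A ≤ t) (ht : t ≤ tailStart R L m) :
    (∑ s : Fin N, (if (s : ℕ) < t then (if inflateWord R L m y s then (1 : ℤ) else -1) else 0))
        - (need R L m t : ℤ) =
      ((∑ s : Fin N, (if (s : ℕ) < A then (if inflateWord R L m y s then (1 : ℤ) else -1) else 0))
        - (need R L m A : ℤ)) +
      ∑ s ∈ (univ : Finset (Fin N)).filter (fun s : Fin N => A ≤ (s : ℕ) ∧ (s : ℕ) < t ∧ s ∉ R),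
        ((if preLetter R L m y (vrank R s) then (1 : ℤ) else -1) -
          (if vrank R s % 2 = 0 ∧ isInflate R L m (vrank R s / 2) = true then 1 else 0)) := by
  induction t, hAt using Nat.le_induction with
  | base =>
    rw [Finset.filter_false_of_mem (fun s _ h => by omega), sum_empty, add_zero]
  | succ t hAt ih =>
    have htN : t < N := lt_of_lt_of_le (by omega) (tailStart_le R L m)
    have hstep := dev_step R L m y ⟨t, htN⟩ (by simp only; omega)
    simp only at hstep
    rw [hstep, ih (by omega)]
    -- the new term `s = t`
    have hsplit : ((univ : Finset (Fin N)).filter fun s : Fin N => A ≤ (s : ℕ) ∧ (s : ℕ) < t + 1 ∧ s ∉ R) =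
        ((univ : Finset (Fin N)).filter fun s : Fin N => A ≤ (s : ℕ) ∧ (s : ℕ) < t ∧ s ∉ R) ∪
          (if (⟨t, htN⟩ : Fin N) ∈ R then ∅ else {⟨t, htN⟩}) := by
      ext s
      simp only [mem_filter, mem_univ, true_and, mem_union]
      constructor
      · rintro ⟨h1, h2, h3⟩
        rcases Nat.lt_succ_iff_lt_or_eq.1 h2 with h | h
        · exact Or.inl ⟨h1, h, h3⟩
        · right
          have : s = ⟨t, htN⟩ := Fin.ext h
          subst this
          rw [if_neg h3]; exact mem_singleton_self _
      · rintro (⟨h1, h2, h3⟩ | h)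
        · exact ⟨h1, by omega, h3⟩
        · split_ifs at h with hm
          · exact absurd h (notMem_empty _)
          · rw [mem_singleton] at h; subst h; exact ⟨hAt, by simp, hm⟩
    have hdisj : Disjoint ((univ : Finset (Fin N)).filter fun s : Fin N => A ≤ (s : ℕ) ∧ (s : ℕ) < t ∧ s ∉ R)
        (if (⟨t, htN⟩ : Fin N) ∈ R then ∅ else {⟨t, htN⟩}) := by
      rw [disjoint_left]; intro s hs hs'
      split_ifs at hs' with hm
      · exact absurd hs' (notMem_empty _)
      · rw [mem_singleton] at hs'; subst hs'
        have := (mem_filter.1 hs).2.2.1; simp at this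
    rw [hsplit, sum_union hdisj]
    by_cases htR : (⟨t, htN⟩ : Fin N) ∈ R
    · rw [if_pos htR, if_pos htR, sum_empty]; ring
    · rw [if_neg htR, if_neg htR, sum_singleton, delta_eq_of_not_mem R L m y htR (by simp only; omega)]
      ring


/-- **The increments as a walk on V-ranks.**  With `A = vpos (2·jA)`, `2·jA ≤ vrank t ≤ #Rᶜ`: the sum of the increments
over the non-defect positions of `[A, t)` is `∑_{2jA ≤ i < vrank t} g i`,
`g i = (preLetter i ? 1 : −1) − [i even ∧ isInflate (i/2)]`. [folklore] -/
theorem sum_delta_eq_sum_Ico (t : ℕ) (hA : 2 * headPairs R L m ≤ vrank R t) :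
    ∑ s ∈ (univ : Finset (Fin N)).filter
        (fun s : Fin N => vpos R (2 * headPairs R L m) ≤ (s : ℕ) ∧ (s : ℕ) < t ∧ s ∉ R),
        ((if preLetter R L m y (vrank R s) then (1 : ℤ) else -1) -
          (if vrank R s % 2 = 0 ∧ isInflate R L m (vrank R s / 2) = true then 1 else 0)) =
      ∑ i ∈ Ico (2 * headPairs R L m) (vrank R t),
        ((if preLetter R L m y i then (1 : ℤ) else -1) -
          (if i % 2 = 0 ∧ isInflate R L m (i / 2) = true then 1 else 0)) := by
  rw [← sum_nondefect_eq_sum_Ico R (fun i => (if preLetter R L m y i then (1 : ℤ) else -1) -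
      (if i % 2 = 0 ∧ isInflate R L m (i / 2) = true then 1 else 0)) hA (vrank_le_card R t)]
  refine sum_congr (filter_congr fun s _ => ?_) fun _ _ => rfl
  constructor
  · rintro ⟨h1, h2, h3⟩; exact ⟨h1, (lt_iff_lt_vpos_vrank R h3 t).1 h2, h3⟩
  · rintro ⟨h1, h2, h3⟩; exact ⟨h1, (lt_iff_lt_vpos_vrank R h3 t).2 h2, h3⟩

/-- **Pair grouping.**  `∑_{2jA ≤ i < v} g i = ∑_{jA ≤ j < v/2} (g (2j) + g (2j+1)) + [v odd]·g (v − 1)`, and every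
`g i` has absolute value `≤ 2`. [folklore] -/
theorem sum_Ico_eq_pairs_add (g : ℕ → ℤ) (a v : ℕ) (hav : 2 * a ≤ v) :
    ∑ i ∈ Ico (2 * a) v, g i =
      (∑ j ∈ Ico a (v / 2), (g (2 * j) + g (2 * j + 1))) + (if v % 2 = 1 then g (2 * (v / 2)) else 0) := by
  rw [← sum_Ico_two_mul g a (v / 2) (by omega)]
  by_cases hv : v % 2 = 1
  · have h1 : v = 2 * (v / 2) + 1 := by omega
    rw [if_pos hv]
    conv_lhs => rw [h1]
    rw [sum_Ico_succ_top (by omega)]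
  · have h1 : v = 2 * (v / 2) := by omega
    rw [if_neg hv, add_zero]
    conv_lhs => rw [h1]

/-- The increment `g i` has absolute value at most `2`. [folklore] -/
theorem abs_delta_le (i : ℕ) :
    |((if preLetter R L m y i then (1 : ℤ) else -1) -
        (if i % 2 = 0 ∧ isInflate R L m (i / 2) = true then 1 else 0))| ≤ 2 := by
  split_ifs <;> simp

/-- **The pair increment is the centred pair step of `…PairWalkBand`.**  For a middle pair `j`
(`jA ≤ j < #Rᶜ/2`): `g (2j) + g (2j+1) = X_j`, with `X_j` the centred step of the S2 decoders read on bits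
`2j, 2j+1` with `τ j = isInflate j`. [folklore] -/
theorem delta_pair_eq (j : ℕ) (hjA : headPairs R L m ≤ j) (hj : j < Rᶜ.card / 2) :
    ((((if preLetter R L m y (2 * j) then (1 : ℤ) else -1) -
          (if (2 * j) % 2 = 0 ∧ isInflate R L m ((2 * j) / 2) = true then 1 else 0)) +
        ((if preLetter R L m y (2 * j + 1) then (1 : ℤ) else -1) -
          (if (2 * j + 1) % 2 = 0 ∧ isInflate R L m ((2 * j + 1) / 2) = true then 1 else 0)) : ℤ) : ℝ) =
      (if isInflate R L m j then
        (if y ⟨2 * j, by omega⟩ = y ⟨2 * j + 1, by omega⟩ then (1 : ℝ) else -1)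
       else ((if y ⟨2 * j, by omega⟩ then (1 : ℝ) else -1) + (if y ⟨2 * j + 1, by omega⟩ then (1 : ℝ) else -1))) := by
  have h0 := preLetter_mid R L m y (j := j) (e := 0) (by omega) (by omega)
  have h1 := preLetter_mid R L m y (j := j) (e := 1) (by omega) (by omega)
  rw [add_zero] at h0
  have hd2 : (2 * j) / 2 = j := by omega
  have hm2 : (2 * j) % 2 = 0 := by omega
  have hm3 : ¬ ((2 * j + 1) % 2 = 0) := by omega
  rw [h0, h1, dif_pos (by omega : 2 * j < 2 * (Rᶜ.card / 2)), dif_pos (by omega : 2 * j + 1 < 2 * (Rᶜ.card / 2))]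
  simp only [hd2, hm2, true_and, hm3, false_and, if_false, sub_zero, one_ne_zero]
  cases isInflate R L m j <;> cases y ⟨2 * j, by omega⟩ <;> cases y ⟨2 * j + 1, by omega⟩ <;>
    simp [decodePair] <;> norm_num

end Summit.ValiantsHypothesis.ValiantsHypothesis.Theorems.FifoMatching.NNLinearDegreeCofactorHard.InflateBand

end
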